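import Summits.HubbardSuperconductivity.HubbardSuperconductivity.Theses.SpinOnePairBoson
import Literature.MathematicalPhysics.QuantumLattice.ClusterPairBosonCouplings
import HarnessLib

/-!
# Crux `SopAnchorOrder` (stmt-HubbardSuperconductivity-2253; route `SpinOnePairBoson`, rank 4) —
BIRTH SKELETON `Lines/birth.lean` (BC3; registrar `planner-skel-stmt-HubbardSuperconductivity-2253-0`,
2026-08-17, mode skeleton-register: no new routes, no proving beyond the assembly)

THE CRUX (fixed; `Theses/SpinOnePairBoson.lean`, decl `SopAnchorOrder`, rev 2, not restated): there are
a cluster shape `a × b` (`2/(ab) ∈ (0, 1/2)`), a symmetric intra-cluster nearest-neighbour hopping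
pattern `τ`, `U > 0` and `t₀ > 0` such that for every inter-cluster hopping `t' ∈ (0, t₀)`,
eventually in `L` with `2a ∣ L`, `2b ∣ L`, every normalised `(N_L, S^z = 0)`-sector ground state of
the CLUSTER-MODULATED Hubbard torus `H_L(τ, t', U)` (`N_L = 2⌊(1 - 2/(ab))L²/2⌋`: one hole pair per
cluster) has `d_{x²-y²}` pair-field order `c(t')·L⁴ ≤ re ⟨ψ, Δ_d† Δ_d ψ⟩`.

THE LINE = the crux's own INTENDED SECOND LAYER (route header "(i) SopFlatClusterPoint (A) +
SopAdmissibleCouplings (B); (ii) second-order Schrieffer–Wolff; (iii) DRESSING LEMMA; (iv) anisotropic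
corollary if a ≠ b"), cut at its three natural joints — a CERTIFIED COMPUTATION, the PSEUDOSPIN-1
many-body input AT THE REALISED COUPLINGS, and the FERMIONIC Schrieffer–Wolff + dressing transfer —
now TYPED, because the definition request `clusterPairBosonCouplings` (support stmt-…-2429) has
landed (`Literature/…/ClusterPairBosonCouplings.lean`: `interClusterKernel`, `PairBosonCouplings`
with `hA, hB, hB', hC, V` and the six-parameter table `c₀, f, v, g, wOdd, w`). The line is drawn for
SQUARE clusters `b = a` (the D4-symmetric `4 × 4` "plaquette of plaquettes" at `δ = 1/8`, `6 × 6` at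
`δ = 1/18`, …), where the `O(t'²)` model on the `(L/a) × (L/a)` cluster torus is the ISOTROPIC
pseudospin-1 model of crux `SopSpinOneOrder`; the rectangular `a ≠ b` branch (anisotropic effective
model, route header (iv)) is NOT in this line.

1. `stub_flatClusterDesign` — THE DESIGN POINT EXISTS (certified exact diagonalisation of one and two
   `a × a` clusters; (A) + the typed half of (B)): some even-sided square cluster `a`, symmetric `τ`,
   `U > 0` (`2/a² ∈ (0, 1/2)`) and real numbers `(h, r, v, w, D)` with `ClusterWindowAt a τ U h r v w D`
   — the flat pair staircase with strict supporting line, unique sector ground states and nonzero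
   `d`-wave elements (VERBATIM the body of crux `SopFlatClusterPoint` at `b = a`), normalised flat
   states `φ 0, φ 1, φ 2` (`0, 1, 2` hole pairs) whose `O(t'²)` two-cluster couplings
   `clusterPairBosonCouplings hH φ (seam)` across BOTH seam directions are the SAME particle–hole
   symmetric pseudospin-1 bond `(hA = hC = 2(h + r), hB = hB' = 2(h - r), v, w, wOdd = 0, D = 4g)`,
   and the `B₁g` visibility `⟨φ₁|Δ|φ₀⟩ + ⟨φ₂|Δ|φ₁⟩ ≠ 0` (the `S⁺`-channel of `Δ_d` in the gauge
   `hB > 0`) — AND `AdmissibleCouplings h r v w D`: `h > 0`, `-h < r ≤ 0` (reflection-positivity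
   cone `hB ≥ hA > 0`: uniform, not `(π,π)`, condensate), `v ≥ 0`, `w ≤ 0`, easy-plane margin
   `v + 2|w| + 2|D| < 2h` (the region SHAPE of `SopSpinOneOrder`, no rider constant `ρ`). Why it
   might fail: TsaiEtAl2008 p. 3 ("we never find a negative value of κ_N", 16 sites) — no flat
   point; or at every flat point `hB < hA` (the natural sign) / `hA ≠ hC` / `wOdd ≠ 0`. Size M–L
   (interval ED of the `4 × 4` cluster in three charge sectors + the two-cluster pair resolvent).
2. `stub_realisedSpinOneOrder` — THE PSEUDOSPIN-1 INPUT AT THE REALISED POINT: whenever an admissible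
   design realises `(h, r, v, w, D)`, the pseudospin-1 torus model `H_M(h, r, v, w, D)` (VERBATIM the
   Hamiltonian of `SopSpinOneOrder`) has xy order `c·M⁴ ≤ re⟨ψ, S⁺_tot S⁻_tot ψ⟩` in every normalised
   `S^z_tot = 0` ground state, eventually in even `M` (`SpinOneOrderAt`, VERBATIM the consequent of
   `SopSpinOneOrder`). Discharge path: crux stmt-…-2251 `SopSpinOneOrder` proved with an explicit
   rider constant `ρ` covering the design's ratios `|r|/h, |w|/h, |D|/h` (`spinOneOrderAt_of_sop`
   below records the bookkeeping). Printed at `r = w = D = 0`, `0 ≤ v ≤ 2h` for the tracial ground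
   state: Björnberg–Ueltschi 2022 Thm 3.2 + (3.9) (`S = 1`, `d = 2`: margin 2.96 against 2;
   vendored `bjornbergUeltschi2022_ground_lro`); endpoints proved in the tree
   (`kennedy_lieb_shastry_ground_holds`, `kennedy_lieb_shastry_xy_ground_holds`). Why it might fail:
   the riders realised by the cluster exceed what the infrared-bound closure absorbs (the line then
   needs a tighter design, not a new engine). Size L (RP ⇒ GD ⇒ IR ⇒ `T = 0` sum rule with riders,
   canonical-sector RP + Perron–Frobenius for "every sector ground state").
3. `stub_dressing` — SCHRIEFFER–WOLFF + DRESSING (the crux's residual, (ii)+(iii) of the route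
   header): for every admissible design window, xy order of the realised pseudospin-1 model implies
   the anchor body `AnchorOrderAt a a τ U` (VERBATIM the crux body at `b = a`). Content: with `P` the
   product of the clusters' flat three-state manifolds (exactly the ground manifold of the decoupled
   torus in the one-pair-per-cluster sector, isolated by the strict supporting line),
   `H_L(τ, t', U) = E₀ + t'²·[H_M(h, r, v, w, D) + const] ⊕ (gapped complement) + R` on the
   `M = L/a` cluster torus (`secondOrderEffective`; only two-cluster terms occur at second order, and
   they are `clusterPairBosonCouplings` by construction), `‖R‖ = O(t'³)` per cluster; the DRESSING
   LEMMA transports the `S⁺`-condensate through `R` uniformly in `L` and projects it onto the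
   microscopic `Δ_d` through `P Δ_d P = Σ_clusters [(m₁+m₂)/(2√2) S⁺ + (m₁-m₂)/(2√2) R]`,
   `m₁ + m₂ ≠ 0`. Why it might fail = the crux's: no stability theorem for GAPLESS `U(1)` order under
   an extensive non-reflection-positive perturbation (Datta–Fernández–Fröhlich 1996 needs a gap;
   Bravyi–Hastings–Michalakis is for gapped order); cross terms with an `R`-channel. Size L (hardest).

COMPOSITION `SopAnchorOrder_of : Sig.stub_flatClusterDesign → Sig.stub_realisedSpinOneOrder →
Sig.stub_dressing → SopAnchorOrder` (proved, pure logic): take the design `(a, τ, U; h, r, v, w, D)`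
from stub 1, feed its window to stub 2 (order at the realised couplings) and both to stub 3 (anchor
body at `(a, a, τ, U)`), and repackage with `b := a` (`sopAnchorOrder_iff`, `Iff.rfl`).
`SopAnchorOrder_proof : SopAnchorOrder` is the hypothesis-free A12 form (its only `sorryAx`
dependence is through the three stubs).

DISPROOF USED: no `Cruxes/SopAnchorOrder/Disproof.lean` exists (2026-08-17; `ledger crux ls`: no
workfiles); no landed Negative lemma concerns this crux. `ledger negatives --problem
HubbardSuperconductivity` (2 entries) read: (1) `CooperPairDMottWalk.BreathingSelfDual` (stmt-1180) is
false only at the degenerate side `L = 2` — every statement here is eventual in `L` (`∃ L₀`) and in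
`M`; (2) `AposterioriCapRg.KlsOrderOpenness` (stmt-1314: `q = 0` XY order stable under ALL small
`U(1)`-invariant finite-range perturbations) is FALSE by helical Dzyaloshinskii–Moriya twists
(`AposterioriCapRgKlsOrderOpenness_refuted`). `stub_dressing` is NOT an instance: its perturbation is
the specific Schrieffer–Wolff remainder of a REAL (time-reversal even), cluster-inversion-symmetric
Hamiltonian, for which DM terms cannot occur — but the lesson binds any abstract child
"DressingStability": pin the ordering wave vector (reality + inversion covariance), never "all
`U(1)`-invariant perturbations". Honoured constraints of the route's grounder/refuter notes: every
order statement is `⟨Δ†Δ⟩`- or `⟨S⁺S⁻⟩`-type LRO of fixed-charge sector ground states (barrier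
`LROForcesLowLyingStates` respected); `2a ∣ L` kept (RP on the `(L/a)`-torus needs an even side).

Sources: J. E. Björnberg, D. Ueltschi (2022) Thm 3.2, (3.9), Table 1 = arXiv:2204.12896
[BjornbergUeltschi2022]; E. J. Neves, J. F. Perez, Phys. Lett. A 114 (1986) 331 [NevesPerez1986];
T. Kennedy, E. H. Lieb, B. S. Shastry, J. Stat. Phys. 53 (1988) 1019 [KLS1988JSP]; W.-F. Tsai,
H. Yao, A. Läuchli, S. A. Kivelson, PRB 77 (2008) 214502 = arXiv:0803.0933 [TsaiEtAl2008]; H. Yao,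
W.-F. Tsai, S. A. Kivelson, PRB 76 (2007) 161104(R) [YaoTsaiKivelson2007]; W.-F. Tsai, S. A. Kivelson,
PRB 73 (2006) 214510, App. A [TsaiKivelson2006]; T. Kato (1966) II-§2 [Kato1966]; N. Datta,
R. Fernández, J. Fröhlich, J. Stat. Phys. 84 (1996) 455 [DattaFernandezFrohlich1996]. No Literature
definition is introduced; the `def`s below are local vocabulary over existing declarations.
-/

noncomputable section

-- `dupNamespace`: the summit and the problem are both named `HubbardSuperconductivity` (layout D-0022)
set_option linter.dupNamespace false

namespace Summit.HubbardSuperconductivity.HubbardSuperconductivity.Cruxes.SopAnchorOrder.Birth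

open scoped Matrix ComplexOrder
open Literature.Probability.LatticeModels Literature.MathematicalPhysics.QuantumLattice
open Summit.HubbardSuperconductivity.HubbardSuperconductivity.Theses.SpinOnePairBoson
  (SopAnchorOrder SopSpinOneOrder SopFlatClusterPoint)

/-! ### Vocabulary (plain `def`s over existing declarations; all bodies VERBATIM from the route file) -/

/-- The isolated `a × b` cluster Hamiltonian `H_C = -Σ_{p∼q,σ} τ(p,q) c†_{pσ} c_{qσ} + U Σ n↑n↓` on
`Fock (Orb (Fin a ×ₗ Fin b))` — verbatim the `H` of crux `SopFlatClusterPoint`.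
Tsai–Kivelson 2006 eq. (1); Tsai et al. 2008 eq. (1). -/
def clusterHamiltonian (a b : ℕ) (τ : ℕ × ℕ → ℕ × ℕ → ℝ) (U : ℝ) :
    Matrix (Finset (Orb (Lex (Fin a × Fin b)))) (Finset (Orb (Lex (Fin a × Fin b)))) ℂ :=
  (-(∑ p : Lex (Fin a × Fin b), ∑ q : Lex (Fin a × Fin b), ∑ σ : Fin 2, ((if ((ofLex p).1 = (ofLex q).1 ∧ (((ofLex p).2 : ℕ) + 1 = (ofLex q).2 ∨ ((ofLex q).2 : ℕ) + 1 = (ofLex p).2)) ∨ ((ofLex p).2 = (ofLex q).2 ∧ (((ofLex p).1 : ℕ) + 1 = (ofLex q).1 ∨ ((ofLex q).1 : ℕ) + 1 = (ofLex p).1)) then τ (((ofLex p).1 : ℕ), ((ofLex p).2 : ℕ)) (((ofLex q).1 : ℕ), ((ofLex q).2 : ℕ)) else 0 : ℝ) : ℂ) • (creation (orb p σ) * annihilation (orb q σ))) + (U : ℂ) • ∑ p : Lex (Fin a × Fin b), numberOp p 0 * numberOp p 1)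

/-- The cluster `d_{x²-y²}` pair annihilator `Δ = Σ_{p∼q} (±1) c_{p↑} c_{q↓}` (`+1` on bonds along the
second coordinate, `-1` along the first) — verbatim the `Δ` of crux `SopFlatClusterPoint`.
Scalapino 1995 §2 eq. (2.3). -/
def clusterDWave (a b : ℕ) :
    Matrix (Finset (Orb (Lex (Fin a × Fin b)))) (Finset (Orb (Lex (Fin a × Fin b)))) ℂ :=
  (∑ p : Lex (Fin a × Fin b), ∑ q : Lex (Fin a × Fin b), ((if (ofLex p).1 = (ofLex q).1 ∧ (((ofLex p).2 : ℕ) + 1 = (ofLex q).2 ∨ ((ofLex q).2 : ℕ) + 1 = (ofLex p).2) then (1 : ℝ) else if (ofLex p).2 = (ofLex q).2 ∧ (((ofLex p).1 : ℕ) + 1 = (ofLex q).1 ∨ ((ofLex q).1 : ℕ) + 1 = (ofLex p).1) then (-1 : ℝ) else 0 : ℝ) : ℂ) • (annihilation (orb p 0) * annihilation (orb q 1)))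

/-- `FlatClusterPointAt a b τ U μ` — the BODY of crux `SopFlatClusterPoint` at fixed data, verbatim:
(i) flat pair staircase `E(N) = E(ab-2) + μ(N - ab + 2)` on `N ∈ {ab, ab-2, ab-4}` with every other
charge `N ≤ 2ab` strictly above that line; (ii) the ground state in each of the three charge sectors
is unique up to phase; (iii) nonzero `d`-wave pair matrix elements between consecutive flat states.
So `SopFlatClusterPoint ↔ ∃ a b τ U μ, 0 < U ∧ Even (ab) ∧ 2/(ab) ∈ (0,1/2) ∧ τ symmetric ∧
FlatClusterPointAt a b τ U μ` (`sopFlatClusterPoint_iff`, by `Iff.rfl`). Tsai et al. 2008 eq. (3). -/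
def FlatClusterPointAt (a b : ℕ) (τ : ℕ × ℕ → ℕ × ℕ → ℝ) (U μ : ℝ) : Prop :=
  let H : Matrix (Finset (Orb (Lex (Fin a × Fin b)))) (Finset (Orb (Lex (Fin a × Fin b)))) ℂ :=
    clusterHamiltonian a b τ U
  let Δ : Matrix (Finset (Orb (Lex (Fin a × Fin b)))) (Finset (Orb (Lex (Fin a × Fin b)))) ℂ :=
    clusterDWave a b
  (∀ N : ℕ, N ≤ 2 * (a * b) → ((N = a * b ∨ N = a * b - 2 ∨ N = a * b - 4) → groundEnergy H N = groundEnergy H (a * b - 2) + μ * ((N : ℝ) - ((a * b - 2 : ℕ) : ℝ))) ∧ (N ≠ a * b → N ≠ a * b - 2 → N ≠ a * b - 4 → groundEnergy H (a * b - 2) + μ * ((N : ℝ) - ((a * b - 2 : ℕ) : ℝ)) < groundEnergy H N)) ∧ (∀ N : ℕ, (N = a * b ∨ N = a * b - 2 ∨ N = a * b - 4) → ∀ φ φ' : Fock (Orb (Lex (Fin a × Fin b))), IsGroundState H N φ → IsGroundState H N φ' → ∃ z : ℂ, φ' = z • φ) ∧ (∀ φ₀ φ₁ φ₂ : Fock (Orb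 (Lex (Fin a × Fin b))), IsGroundState H (a * b) φ₀ → IsGroundState H (a * b - 2) φ₁ → IsGroundState H (a * b - 4) φ₂ → star φ₁ ⬝ᵥ Matrix.mulVec Δ φ₀ ≠ 0 ∧ star φ₂ ⬝ᵥ Matrix.mulVec Δ φ₁ ≠ 0)

/-- The CLUSTER-MODULATED Hubbard torus `H_L(τ, t', U)` of the crux, verbatim: hopping `τ(local
coordinates)` on nearest-neighbour bonds inside an `a × b` cluster (labels `(⌊x₀/a⌋, ⌊x₁/b⌋)`, locals
`(x₀ % a, x₁ % b)`), `t'` on bonds between clusters, on-site `U`; `H_L(1, 1, U) = hubbardTorus 2 L 1 U`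
propositionally. Tsai–Kivelson 2006 eq. (1) (checkerboard case). -/
def modulatedHamiltonian (L a b : ℕ) (τ : ℕ × ℕ → ℕ × ℕ → ℝ) (t' U : ℝ) :
    Matrix (Finset (Orb (FermionTorus 2 L))) (Finset (Orb (FermionTorus 2 L))) ℂ :=
  (-(∑ x : FermionTorus 2 L, ∑ y : FermionTorus 2 L, ∑ σ : Fin 2, (((if (fermionTorusGraph 2 L).Adj x y then (if ((ofLex x) 0 : ℕ) / a = ((ofLex y) 0 : ℕ) / a ∧ ((ofLex x) 1 : ℕ) / b = ((ofLex y) 1 : ℕ) / b then τ (((ofLex x) 0 : ℕ) % a, ((ofLex x) 1 : ℕ) % b) (((ofLex y) 0 : ℕ) % a, ((ofLex y) 1 : ℕ) % b) else t') else 0 : ℝ)) : ℂ) • (creation (orb x σ) * annihilation (orb y σ))) + (U : ℂ) • ∑ x : FermionTorus 2 L, numberOp x 0 * numberOp x 1)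

/-- `AnchorOrderAt a b τ U` — the BODY of the crux at fixed `(a, b, τ, U)`, verbatim:
`∃ t₀ > 0, ∀ t' ∈ (0, t₀), ∃ c > 0, ∃ L₀, ∀ L ≥ L₀` with `2a ∣ L`, `2b ∣ L`, every normalised
`(N_L, S^z = 0)`-sector ground state `ψ` of `H_L(τ, t', U)`, `N_L = 2⌊(1 - 2/(ab))L²/2⌋`, has
`c·L⁴ ≤ re ⟨ψ, Δ_d† Δ_d ψ⟩` (`Δ_d = pairField dWaveFormFactor L`). So `SopAnchorOrder ↔ ∃ a b τ U,
0 < U ∧ 2/(ab) ∈ (0,1/2) ∧ τ symmetric ∧ AnchorOrderAt a b τ U` (`sopAnchorOrder_iff`, by `Iff.rfl`). -/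
def AnchorOrderAt (a b : ℕ) (τ : ℕ × ℕ → ℕ × ℕ → ℝ) (U : ℝ) : Prop :=
  ∃ t₀ : ℝ, 0 < t₀ ∧ ∀ t' ∈ Set.Ioo (0:ℝ) t₀, ∃ c : ℝ, 0 < c ∧ ∃ L₀ : ℕ, ∀ (L : ℕ) [NeZero L],
    L₀ ≤ L → 2 * a ∣ L → 2 * b ∣ L → ∀ (N : ℕ) (ψ : Fock (Orb (FermionTorus 2 L))),
      N = 2 * ⌊(1 - (2 : ℝ) / ((a : ℝ) * (b : ℝ))) * (L : ℝ) ^ 2 / 2⌋₊ → star ψ ⬝ᵥ ψ = 1 →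
      IsGroundStateInSector (modulatedHamiltonian L a b τ t' U) N 0 ψ →
      c * (L : ℝ) ^ 4 ≤ (expect (Matrix.conjTranspose (pairField dWaveFormFactor L) *
        pairField dWaveFormFactor L) ψ).re

/-- The pseudospin-1 torus Hamiltonian `H_M(h, r, v, w, D) = Σ_{x∼y, ordered} [-h S⁺_xS⁻_y - r R_xR†_y
+ (v/2) S^z_xS^z_y + (w/2) (S^z_x)²(S^z_y)²] + D Σ_x (S^z_x)²`, `R = S^zS⁺ + S⁺S^z` (sign immaterial in
`R R†`) — verbatim the `let H` of crux `SopSpinOneOrder` (route dictionary: `k` hole pairs ↦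
`S^z = k - 1`; `hA = hC = 2(h + r)`, `hB = 2(h - r)`). Björnberg–Ueltschi 2022 eq. (2.4) at
`r = w = D = 0`. -/
def spinOneHamiltonian (M : ℕ) [NeZero M] (h r v w D : ℝ) : Op (TorusSite 2 M) 3 :=
  (∑ x : TorusSite 2 M, ∑ y : TorusSite 2 M, if (torusGraph 2 M).Adj x y then ( -((h : ℂ) • (onSite x (spinRaise 2) * onSite y (spinLower 2))) - (r : ℂ) • (onSite x (SpinOperators.spinZ 2 * spinRaise 2 + spinRaise 2 * SpinOperators.spinZ 2) * onSite y (Matrix.conjTranspose (SpinOperators.spinZ 2 * spinRaise 2 + spinRaise 2 * SpinOperators.spinZ 2))) + ((v / 2 : ℝ) : ℂ) • (onSite x (SpinOperators.spinZ 2) * onSite y (SpinOperators.spinZ 2)) + ((w / 2 : ℝ) : ℂ) • (onSite x (SpinOperators.spinZ 2 * SpinOperators.spinZ 2) * onSite y (SpinOperators.spinZ 2 * SpinOperators.spinZ 2)) ) else 0) + (D : ℂ) • ∑ x : TorusSite 2 M, onSite x (SpinOperators.spinZ 2 * SpinOperators.spinZ 2)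

/-- `SpinOneOrderAt h r v w D` — xy order of the pseudospin-1 model at ONE coupling point, verbatim
the consequent of crux `SopSpinOneOrder`: `∃ c > 0, ∃ M₀`, for every even `M ≥ M₀` and every
normalised `S^z_tot = 0`-sector ground state `ψ` of `H_M(h, r, v, w, D)`,
`c·M⁴ ≤ re ⟨ψ, S⁺_tot S⁻_tot ψ⟩` (pair condensate). Neves–Perez 1986; Björnberg–Ueltschi 2022
Thm 3.2. -/
def SpinOneOrderAt (h r v w D : ℝ) : Prop :=
  ∃ c : ℝ, 0 < c ∧ ∃ M₀ : ℕ, ∀ (M : ℕ) [NeZero M], Even M → M₀ ≤ M →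
    ∀ (ψ : TensorIndex (TorusSite 2 M) 3 → ℂ),
      ψ ∈ spinZSector (Λ := TorusSite 2 M) 2 0 → star ψ ⬝ᵥ ψ = 1 →
      Matrix.mulVec (spinOneHamiltonian M h r v w D) ψ =
        ((lowestEnergyInSector 2 (spinOneHamiltonian M h r v w D) 0 : ℝ) : ℂ) • ψ →
      c * (M : ℝ) ^ 4 ≤ (star ψ ⬝ᵥ Matrix.mulVec
        ((∑ x : TorusSite 2 M, onSite x (spinRaise 2)) * (∑ y : TorusSite 2 M, onSite y (spinLower 2)))
        ψ).re

/-- `AdmissibleCouplings h r v w D` — the EXPLICIT inequalities of the design target (the region SHAPE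
of `SopSpinOneOrder` without its rider constant `ρ`): `h > 0`; `-h < r ≤ 0`, i.e. the
reflection-positivity cone `hB = 2(h - r) ≥ hA = 2(h + r)` together with `hA > 0` (uniform, not
`(π,π)`, pair condensate — else the order is invisible to the uniform `Δ_d`); antiferro Ising rider
`v ≥ 0`; biquadratic rider `w ≤ 0`; strict easy-plane margin `v + 2|w| + 2|D| < 2h` (open, hence
certifiable by interval arithmetic). Card spin-one-escape-neves-perez (RP cone); B–U 2022 (3.9). -/
def AdmissibleCouplings (h r v w D : ℝ) : Prop :=
  0 < h ∧ -h < r ∧ r ≤ 0 ∧ 0 ≤ v ∧ w ≤ 0 ∧ v + 2 * |w| + 2 * |D| < 2 * h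

/-- The seam between two `a × a` clusters adjacent in the FIRST coordinate: boundary site pairs
`(p, q)` with `p = (a-1, j)` in cluster 1 and `q = (0, j)` in cluster 2 (unit inter-cluster hopping,
`bondHopping`). [bookkeeping] -/
def seamFst (a : ℕ) : Finset (Lex (Fin a × Fin a) × Lex (Fin a × Fin a)) :=
  Finset.univ.filter fun pq =>
    ((ofLex pq.1).1 : ℕ) + 1 = a ∧ ((ofLex pq.2).1 : ℕ) = 0 ∧ (ofLex pq.1).2 = (ofLex pq.2).2

/-- The seam between two `a × a` clusters adjacent in the SECOND coordinate: `p = (i, a-1)`,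
`q = (i, 0)`. [bookkeeping] -/
def seamSnd (a : ℕ) : Finset (Lex (Fin a × Fin a) × Lex (Fin a × Fin a)) :=
  Finset.univ.filter fun pq =>
    ((ofLex pq.1).2 : ℕ) + 1 = a ∧ ((ofLex pq.2).2 : ℕ) = 0 ∧ (ofLex pq.1).1 = (ofLex pq.2).1

/-- `RealisesCouplings C h r v w D` — the `O(t'²)` two-cluster couplings `C` ARE the particle–hole
symmetric pseudospin-1 bond of `SopSpinOneOrder` with parameters `(h, r, v, w, D)`: correlated pair
hoppings `hA = hC = 2(h + r)` (lone pair / pair next to a pair), `hB = hB' = 2(h - r)` (onto/off an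
occupied cluster; reflection-symmetric seam; this equality also FIXES THE GAUGE `θ₀ + θ₂ - 2θ₁` of the
flat states), Ising `C.v = v`, biquadratic `C.w = w`, PH-odd diagonal `C.wOdd = 0`, and single-ion
`D = 4·g` (each cluster lies on `2 + 2` seams of the square superlattice; `PairBosonCouplings.g`).
The constant `c₀` and the field `f` of the table are constants in a fixed `S^z_tot` sector.
Yao–Tsai–Kivelson 2007 eq. (2); `PairBosonCouplings.table_eq`. -/
def RealisesCouplings (C : PairBosonCouplings) (h r v w D : ℝ) : Prop :=
  C.hA = 2 * (h + r) ∧ C.hB = 2 * (h - r) ∧ C.hB' = 2 * (h - r) ∧ C.hC = 2 * (h + r) ∧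
    C.v = v ∧ C.w = w ∧ C.wOdd = 0 ∧ 4 * C.g = D

/-- `ClusterWindowAt a τ U h r v w D` — the DESIGN WINDOW of the square cluster `a × a` at `(τ, U)`
realising the pseudospin-1 couplings `(h, r, v, w, D)`: for some staircase slope `μ`, some flat
states `φ : Fin 3 → Fock` and the Hermiticity of `H_C` (a `Prop`, quantified so that
`clusterPairBosonCouplings` can be applied; true for symmetric real `τ`):
(a) `FlatClusterPointAt a a τ U μ` (crux `SopFlatClusterPoint` at `b = a`);
(b) `φ k` is a normalised ground state with `a² - 2k` electrons (`k = 0, 1, 2` hole pairs; unique up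
to phase by (a)(ii), hence a singlet and real up to phase);
(c) the `O(t'²)` couplings across the first-coordinate seam AND across the second-coordinate seam both
realise `(h, r, v, w, D)` (seam isotropy: the effective model on the `(L/a) × (L/a)` cluster torus is
the isotropic `H_M(h, r, v, w, D)` up to a sector constant);
(d) visibility of the condensing channel in `Δ_d`: `m₁ + m₂ ≠ 0`, `m₁ = ⟨φ₁|Δ|φ₀⟩`,
`m₂ = ⟨φ₂|Δ|φ₁⟩` in the gauge of (c) (`P Δ_d P = Σ [(m₁+m₂)/(2√2) S⁺ + (m₁-m₂)/(2√2) R]`).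
Everything here is a finite-dimensional statement about one or two clusters (certifiable by interval
exact diagonalisation). Tsai–Kivelson 2006 App. A; Yao–Tsai–Kivelson 2007 eq. (2). -/
def ClusterWindowAt (a : ℕ) (τ : ℕ × ℕ → ℕ × ℕ → ℝ) (U h r v w D : ℝ) : Prop :=
  ∃ (μ : ℝ) (φ : Fin 3 → Fock (Orb (Lex (Fin a × Fin a))))
    (hH : (clusterHamiltonian a a τ U).IsHermitian),
    FlatClusterPointAt a a τ U μ ∧
    (∀ k : Fin 3, IsGroundState (clusterHamiltonian a a τ U) (a * a - 2 * (k : ℕ)) (φ k) ∧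
      star (φ k) ⬝ᵥ φ k = 1) ∧
    RealisesCouplings (clusterPairBosonCouplings hH φ (seamFst a)) h r v w D ∧
    RealisesCouplings (clusterPairBosonCouplings hH φ (seamSnd a)) h r v w D ∧
    star (φ 1) ⬝ᵥ Matrix.mulVec (clusterDWave a a) (φ 0) +
      star (φ 2) ⬝ᵥ Matrix.mulVec (clusterDWave a a) (φ 1) ≠ 0

/-! ### Stub signatures (`Sig.stub_*`: the hypothesis heads of `SopAnchorOrder_of` carry the stub names) -/

/-- STUB 1 signature — an admissible flat square design exists. -/
def Sig.stub_flatClusterDesign : Prop :=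
  ∃ (a : ℕ) (τ : ℕ × ℕ → ℕ × ℕ → ℝ) (U h r v w D : ℝ), 0 < U ∧ Even (a * a) ∧
    (2 : ℝ) / ((a : ℝ) * (a : ℝ)) ∈ Set.Ioo (0:ℝ) (1 / 2) ∧ (∀ p q, τ p q = τ q p) ∧
    AdmissibleCouplings h r v w D ∧ ClusterWindowAt a τ U h r v w D

/-- STUB 2 signature — xy order of the pseudospin-1 model at every admissibly REALISED coupling point. -/
def Sig.stub_realisedSpinOneOrder : Prop :=
  ∀ (a : ℕ) (τ : ℕ × ℕ → ℕ × ℕ → ℝ) (U h r v w D : ℝ), 0 < U → (∀ p q, τ p q = τ q p) →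
    AdmissibleCouplings h r v w D → ClusterWindowAt a τ U h r v w D → SpinOneOrderAt h r v w D

/-- STUB 3 signature — Schrieffer–Wolff + dressing: inside an admissible window, order of the realised
pseudospin-1 model gives the anchor body at `(a, a, τ, U)`. -/
def Sig.stub_dressing : Prop :=
  ∀ (a : ℕ) (τ : ℕ × ℕ → ℕ × ℕ → ℝ) (U h r v w D : ℝ), 0 < U → (∀ p q, τ p q = τ q p) →
    AdmissibleCouplings h r v w D → ClusterWindowAt a τ U h r v w D → SpinOneOrderAt h r v w D →
    AnchorOrderAt a a τ U

/-! ### Registered stubs (sorries live ONLY here) -/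

/-- **STUB 1 `stub_flatClusterDesign` — THE DESIGN POINT EXISTS** (certified exact diagonalisation of
one and two square clusters; (A) = crux `SopFlatClusterPoint` at `b = a` plus the typed half of
(B) = support `SopAdmissibleCouplings`). Some even `a` (`2/a² ∈ (0, 1/2)`: the D4-symmetric `4 × 4`
"plaquette of plaquettes" at `δ = 1/8` is the intended one), symmetric n.n. pattern `τ`, `U > 0` and
reals `(h, r, v, w, D)` with: flat pair staircase + strict supporting line + unique sector ground
states + nonzero `d`-wave elements; normalised flat states whose `O(t'²)` couplings across both seam
directions are the SAME particle–hole symmetric pseudospin-1 bond `(2(h+r), 2(h-r), 2(h-r), 2(h+r);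
v, w, wOdd = 0, D = 4g)`; visibility `m₁ + m₂ ≠ 0`; and the explicit inequalities
`AdmissibleCouplings` (`h > 0`, `-h < r ≤ 0`, `v ≥ 0`, `w ≤ 0`, `v + 2|w| + 2|D| < 2h`). Knobs: `U`
and the bond-class ratios of `τ` (three D4 classes on `4 × 4`) against the equations `κ = 0`,
`hA = hC`, `wOdd = 0`. Why it might fail: Tsai et al. 2008 p. 3, eq. (3): "we never find a negative
value of κ_N" (≤ 16 sites) — no transversal zero of `κ`; or the natural sign `hB < hA` at every flat
point. Tsai et al. 2008; Tsai–Kivelson 2006 App. A; Yao–Tsai–Kivelson 2007 eq. (2). -/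
theorem stub_flatClusterDesign :
    ∃ (a : ℕ) (τ : ℕ × ℕ → ℕ × ℕ → ℝ) (U h r v w D : ℝ), 0 < U ∧ Even (a * a) ∧
      (2 : ℝ) / ((a : ℝ) * (a : ℝ)) ∈ Set.Ioo (0:ℝ) (1 / 2) ∧ (∀ p q, τ p q = τ q p) ∧
      AdmissibleCouplings h r v w D ∧ ClusterWindowAt a τ U h r v w D := by
  sorry

/-- **STUB 2 `stub_realisedSpinOneOrder` — THE PSEUDOSPIN-1 INPUT AT THE REALISED POINT** (reflection
positivity on the PH cone ⇒ Gaussian domination ⇒ infrared bound ⇒ `T = 0` sum rule, with riders).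
For every admissible design window realising `(h, r, v, w, D)`: every normalised `S^z_tot = 0` ground
state of `H_M(h, r, v, w, D)` on `(ℤ/Mℤ)²` has `c·M⁴ ≤ re⟨ψ, S⁺_tot S⁻_tot ψ⟩`, eventually in even `M`.
At `r = w = D = 0`, `0 ≤ v ≤ 2h`, tracial ground state: Björnberg–Ueltschi 2022 Thm 3.2 + (3.9)
(`S = 1`, `d = 2`, `(4/3)S(S+1)/(I Ĩ) = 2.96 > 1 + v/2h`); endpoints proved in the tree
(`kennedy_lieb_shastry_ground_holds`, `kennedy_lieb_shastry_xy_ground_holds`). Discharged by crux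
`SopSpinOneOrder` (stmt-…-2251) with any explicit `ρ ≥ max(|r|, |w|, |D|)/h` of the design
(`spinOneOrderAt_of_sop`). Why it might fail: the realised riders exceed the closure margin of the
infrared bound (48 % at the Heisenberg end); every-sector-GS needs canonical RP + Perron–Frobenius
(stoquastic signs `hA, hB > 0` are in the window). Neves–Perez 1986; KLS 1988; B–U 2022 pp. 9–11. -/
theorem stub_realisedSpinOneOrder :
    ∀ (a : ℕ) (τ : ℕ × ℕ → ℕ × ℕ → ℝ) (U h r v w D : ℝ), 0 < U → (∀ p q, τ p q = τ q p) →
      AdmissibleCouplings h r v w D → ClusterWindowAt a τ U h r v w D →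
      SpinOneOrderAt h r v w D := by
  sorry

/-- **STUB 3 `stub_dressing` — SCHRIEFFER–WOLFF + DRESSING** (the crux's residual). For every
admissible design window of a square cluster: xy order of the realised pseudospin-1 model implies the
anchor body at `(a, a, τ, U)` — some `t₀ > 0`, all `t' ∈ (0, t₀)`, eventually in `L` with `2a ∣ L`,
every normalised `(N_L, S^z = 0)`-sector ground state of `H_L(τ, t', U)` has `c·L⁴ ≤ re⟨Δ_d†Δ_d⟩`.
Mechanism: second-order Schrieffer–Wolff (`secondOrderEffective`, Kato II-§2) onto the product of the
flat three-state manifolds — the exact ground manifold of the decoupled torus in the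
one-pair-per-cluster sector, gapped by the strict supporting line — gives
`E₀ + t'²·[H_M(h, r, v, w, D) + const]` on the `M = L/a` cluster torus (only two-cluster terms at
second order; they are `clusterPairBosonCouplings` of the two seams) plus `R = O(t'³)` per cluster;
the DRESSING LEMMA carries the `S⁺`-condensate through `R` uniformly in `L` and projects it on `Δ_d`
with weight `|m₁ + m₂|²/8`. Why it might fail = the crux's: no stability theorem for gapless `U(1)`
order under an extensive non-reflection-positive perturbation (DFF 1996 needs a gap); `R`-channel
cross terms; `t₀ → 0` with the charge gaps. Kato 1966 II-§2; Datta–Fernández–Fröhlich 1996;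
Tsai–Kivelson 2006 App. A. -/
theorem stub_dressing :
    ∀ (a : ℕ) (τ : ℕ × ℕ → ℕ × ℕ → ℝ) (U h r v w D : ℝ), 0 < U → (∀ p q, τ p q = τ q p) →
      AdmissibleCouplings h r v w D → ClusterWindowAt a τ U h r v w D → SpinOneOrderAt h r v w D →
      AnchorOrderAt a a τ U := by
  sorry

/-! ### Bookkeeping (proved) -/

/-- The crux unfolds to `∃ a b τ U, 0 < U ∧ 2/(ab) ∈ (0,1/2) ∧ τ symmetric ∧ AnchorOrderAt a b τ U`.
[bookkeeping] -/
theorem sopAnchorOrder_iff :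
    SopAnchorOrder ↔ ∃ (a b : ℕ) (τ : ℕ × ℕ → ℕ × ℕ → ℝ) (U : ℝ), 0 < U ∧
      (2 : ℝ) / ((a : ℝ) * (b : ℝ)) ∈ Set.Ioo (0:ℝ) (1 / 2) ∧ (∀ p q, τ p q = τ q p) ∧
      AnchorOrderAt a b τ U :=
  Iff.rfl

/-- Crux `SopFlatClusterPoint` unfolds to the prefixed `FlatClusterPointAt` (so the design window of
stub 1 contains that crux at `b = a`). [bookkeeping] -/
theorem sopFlatClusterPoint_iff :
    SopFlatClusterPoint ↔ ∃ (a b : ℕ) (τ : ℕ × ℕ → ℕ × ℕ → ℝ) (U μ : ℝ), 0 < U ∧ Even (a * b) ∧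
      (2 : ℝ) / ((a : ℝ) * (b : ℝ)) ∈ Set.Ioo (0:ℝ) (1 / 2) ∧ (∀ p q, τ p q = τ q p) ∧
      FlatClusterPointAt a b τ U μ :=
  Iff.rfl

/-- Crux `SopSpinOneOrder` unfolds to "`SpinOneOrderAt` on the rider cone of some width `ρ > 0`".
[bookkeeping] -/
theorem sopSpinOneOrder_iff :
    SopSpinOneOrder ↔ ∃ ρ : ℝ, 0 < ρ ∧ ∀ (h r v w D : ℝ), 0 < h → -(ρ * h) ≤ r → r ≤ 0 → 0 ≤ v →
      -(ρ * h) ≤ w → w ≤ 0 → |D| ≤ ρ * h → v + 2 * |w| + 2 * |D| ≤ 2 * h →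
      SpinOneOrderAt h r v w D :=
  Iff.rfl

/-- Stub 1 delivers crux `SopFlatClusterPoint` (at `b = a`). [bookkeeping] -/
theorem sopFlatClusterPoint_of_design (h₁ : Sig.stub_flatClusterDesign) : SopFlatClusterPoint := by
  obtain ⟨a, τ, U, h, r, v, w, D, hU, hev, hδ, hτ, -, μ, φ, hH, hflat, -⟩ := h₁
  exact sopFlatClusterPoint_iff.2 ⟨a, a, τ, U, μ, hU, hev, hδ, hτ, hflat⟩

/-- DISCHARGE PATH of stub 2 through crux `SopSpinOneOrder` (stmt-…-2251): if that crux holds with a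
rider constant `ρ` and the admissible point has `|r|, |w|, |D| ≤ ρh`, then `SpinOneOrderAt` holds
there. [bookkeeping] -/
theorem spinOneOrderAt_of_sop {ρ h r v w D : ℝ}
    (hρ : ∀ (h r v w D : ℝ), 0 < h → -(ρ * h) ≤ r → r ≤ 0 → 0 ≤ v → -(ρ * h) ≤ w → w ≤ 0 →
      |D| ≤ ρ * h → v + 2 * |w| + 2 * |D| ≤ 2 * h → SpinOneOrderAt h r v w D)
    (hadm : AdmissibleCouplings h r v w D) (hr : -(ρ * h) ≤ r) (hw : -(ρ * h) ≤ w)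
    (hD : |D| ≤ ρ * h) : SpinOneOrderAt h r v w D := by
  obtain ⟨hh, -, hr0, hv, hw0, hmargin⟩ := hadm
  exact hρ h r v w D hh hr hr0 hv hw hw0 hD hmargin.le

/-! ### Composition -/

/-- **The line closes the crux BY NAME modulo the three registered stubs.** Take the design
`(a, τ, U; h, r, v, w, D)` from stub 1; stub 2 gives xy order of the realised pseudospin-1 model;
stub 3 turns it into the anchor body at `(a, a, τ, U)`; repackage with `b := a`. -/
theorem SopAnchorOrder_of :
    Sig.stub_flatClusterDesign → Sig.stub_realisedSpinOneOrder → Sig.stub_dressing →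
      SopAnchorOrder := by
  rintro ⟨a, τ, U, h, r, v, w, D, hU, hev, hδ, hτ, hadm, hW⟩ hO hD
  have hord : SpinOneOrderAt h r v w D := hO a τ U h r v w D hU hτ hadm hW
  have hanchor : AnchorOrderAt a a τ U := hD a τ U h r v w D hU hτ hadm hW hord
  exact sopAnchorOrder_iff.2 ⟨a, a, τ, U, hU, hδ, hτ, hanchor⟩

/-- The skeleton in its final shape (A12): the crux BY NAME from the three registered stubs; it becomes
the crux proof when the last `stub_*` is discharged (until then it depends on `sorryAx` through the
stubs only — no `sorry` of its own). -/
theorem SopAnchorOrder_proof : SopAnchorOrder :=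
  SopAnchorOrder_of stub_flatClusterDesign stub_realisedSpinOneOrder stub_dressing

end Summit.HubbardSuperconductivity.HubbardSuperconductivity.Cruxes.SopAnchorOrder.Birth

end
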